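import Summits.QuantumFields.BalabanUV.Beta.GAN24.CombBornLambdaLineage
import Summits.QuantumFields.BalabanUV.Beta.GAN24.BornLambdaDrift

/-!
# The RATE halves of the (III′) born rows: the all-scales Cauchy letters of the Λ-born and of the V-born remainders of the comb-chart family,
# REDUCED TO TOP-LINEAGE AND TOP-ALIGNED PAIR LETTERS (sockets; leaf-06's sector-free schema BY NAME)

NOT IN PRINT — OUR BOOKKEEPING (road-P2 = `b2b-balaban-gan24-p2` gen 56, 2026-08-25; row G-an2-4 ∕ (CONV-C), the (α-0) chain at row D1's literal
OF RECORD (III′) `JsB12CombShSym`; [folklore] composition BY NAME; 0 `def`, 0 cite, 0 `def … : Prop`, 0 `sorry`).  Weight 0.  NEVER «G-an2-4 closed» as (CONV-C);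
NOT D1, NOT BetaPertH, NOT continuum, NOT Clay; NO campaign opened (an2 W-4).

This is the (III′) twin of leaf-06 g41's (E) `GAN24/BornLambdaDrift` §2 and leaf-04 g57's (E) `GAN24/BornBorderDrift` §1 (the rate halves `hBdev(0,cΛ)` ∕ `hBdev(cVH,0)`
as SOCKETS) over M.58 `CombBornLambdaLineage.unitS_combBornLam_eq_sum_push₃` (Λ: fresh source + weighted pushes through the CONJUGATED chains
`T″ = legChain (fun j ↦ legComp ψ♭ (respStepBmSeq ρ_c Lc j))`) and M.56 `CombBornBorderLineage.unitS_combBornV_eq_sum` (V: the SAME table `cVH • tabs.V` at every level +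
transported one-step images), with leaf-06's SECTOR-FREE schema `BornLambdaDrift.exists_consec_of_pairLetters` ∕ `locStencil_allScales_of_consec` BY NAME, for ANY
`tabs : SymTables d Lc` (ff-valued Hessian table `hHff` for the Λ half; off-diagonal border `hVff hVmm` for the V half):
* §1 **`exists_hBdevLam_of_letters (hHff) (cE cΛ) (hXd hT hP)`** — fresh Λ-source drift `CF·θF^k` + top lineage `CT·(k+1)^p·θT^{k+1}` + top-aligned pairs
  `CP·(k−i)^q·Θ^k` ⇒ `∃ cB θB δB, 0 ≤ cB ∧ 0 ≤ θB ∧ θB < 1 ∧ 0 < δB ∧ ∀ k j, LocStencil (unitS_{k+j} (combBornOf Lc tabs cE 0 cΛ (k+j)) − unitS_k (combBornOf Lc tabs cE 0 cΛ k)) (cB·θB^k) δB`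
  = the letter `hL` of M.57 `CombBornSectorSplit.exists_hBd_of_sectors` VERBATIM.
* §2 **`exists_hBdevV_of_letters (hVff hVmm) (cE cVH) (hT hP)`** — the V source is constant in the level, so its drift letter is ZERO: top lineage + pairs ⇒ the letter
  `hV` of M.57 `exists_hBd_of_sectors` VERBATIM.
At (III′) there is no in-block-root quantifier (centred roots).  The letters are HYPOTHESES: their (E) discharges (`BornLambdaDrift` §3, `BornBorderDriftThree`) read road S3's
rooted rows and the contact cells, whose (III′) twins are NOT typed (located in road-P2's INTENT-9∕10∕11: transported V table, `tabs.H`, `T″ − B = λ + PsiFace`).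
Discharges NO letter; NO estimate; NO value ∕ rate of Bałaban's tables.
-/

noncomputable section

open Finset
open scoped BigOperators
open Literature.MathematicalPhysics.QuantumFieldTheory
open Literature.MathematicalPhysics.QuantumFieldTheory.Balaban1983to89
open Literature.MathematicalPhysics.QuantumFieldTheory.Balaban1983to89.Beta
open ExpKernelCalculus (MKer comp)
open AffineAveraging (Site box toSite)
open AveragingContoursRooted (ctr ctrOff)
open OneStepResolventKernel (Fib LocStencil)
open BalabanCompositeJets (respStep)
open Summit.QuantumFields.BalabanUV.Beta.HessKerDressedUnits (unitS)
open Summit.QuantumFields.BalabanUV.Beta.SymCorrectorKernel (psiKS)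
open Summit.QuantumFields.BalabanUV.Beta.SymmetrisedStepJets (SymTables)
open Summit.QuantumFields.BalabanUV.Beta.GAN24.CombesThomas (sfStep smStep)
open Summit.QuantumFields.BalabanUV.Beta.GAN24.StencilSlotOfShapes (locStencil_mono')
open Summit.QuantumFields.BalabanUV.Beta.GAN24.Push4 (legComp IsFF)
open Summit.QuantumFields.BalabanUV.Beta.GAN24.Push4Iter (legChain)
open Summit.QuantumFields.BalabanUV.Beta.GAN24.Push3 (push₃)
open Summit.QuantumFields.BalabanUV.Beta.GAN24.AffineUnroll (transport)
open Summit.QuantumFields.BalabanUV.Beta.GAN24.RespStepBmDecompExact (respStepBmSeq)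
open Summit.QuantumFields.BalabanUV.Beta.GAN24.BornLambdaDrift (exists_consec_of_pairLetters locStencil_allScales_of_consec)
open Summit.QuantumFields.BalabanUV.Beta.GAN24.CombWilsonSector (combBornOf)
open Summit.QuantumFields.BalabanUV.Beta.GAN24.CombBornSector (combFreshAt combUnitStepMap)
open Summit.QuantumFields.BalabanUV.Beta.GAN24.CombBornBorderLineage (unitS_combBornV_eq_sum)
open Summit.QuantumFields.BalabanUV.Beta.GAN24.CombBornLambdaLineage (unitS_combBornLam_eq_sum_push₃)

namespace Summit.QuantumFields.BalabanUV.Beta.GAN24.CombBornDriftSockets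

variable {d : ℕ} {Lc : ℕ} [NeZero Lc] (tabs : SymTables d Lc)

/-! ## §1 The Λ half: `hBdev(0,cΛ)` at (III′) from three letters -/

/-- NOT IN PRINT; OUR BOOKKEEPING (generic `d`, centred roots; a SOCKET; the (III′) twin of leaf-06's `BornLambdaDrift.exists_hBdevLam_of_letters`).  **THE RATE HALF OF THE
(III′) Λ-BORN ROW FROM THREE LETTERS**: a fresh-source drift `hXd` (`CF·θF^k`, the Λ-pieces at `tabs.H` in units), a TOP-lineage letter `hT` (born at the finest level,
observed at `k+1` through the conjugated chain `T″ = legChain (fun j ↦ legComp ψ♭ R_j) 0 k`: `CT·(k+1)^p·θT^{k+1}`) and the TOP-ALIGNED PAIR letters `hP` (member `k+1`'s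
lineage born at `i+1` minus member `k`'s born at `i`: `CP·(k−i)^q·Θ^k`) give the all-scales Cauchy letter of the unit tables of `combBornOf Lc tabs cE 0 cΛ` — ONE
`cB ≥ 0`, ONE `0 ≤ θB < 1`, ONE `δB > 0` for all `k j` (leaf-06's schema `exists_consec_of_pairLetters` + `locStencil_allScales_of_consec` under M.58's display). -/
theorem exists_hBdevLam_of_letters (hHff : ∀ μ y, IsFF (tabs.H μ y)) (cE cΛ : ℝ) {p q : ℕ}
    (hXd : ∃ CF θF δF : ℝ, 0 ≤ CF ∧ 0 ≤ θF ∧ θF < 1 ∧ 0 < δF ∧ ∀ k : ℕ,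
      LocStencil (unitS (sfStep Lc (k + 1)) (smStep d Lc (k + 1)) (combFreshAt tabs 0 cΛ (k + 1))
        - unitS (sfStep Lc k) (smStep d Lc k) (combFreshAt tabs 0 cΛ k)) (CF * θF ^ k) δF)
    (hT : ∃ CT θT δT : ℝ, 0 ≤ CT ∧ 0 ≤ θT ∧ θT < 1 ∧ 0 < δT ∧ ∀ k : ℕ,
      LocStencil (fun κ' u' => (cE * (Lc : ℝ) ^ (2 * (d + 1))) ^ (k + 1) •
        push₃
          (legChain (fun j => legComp (fun α x κ u => psiKS (ctrOff (d + 1) Lc) Lc u x (Sum.inl κ) (Sum.inl α)) (respStepBmSeq (d := d) (ctr (d + 1) Lc) Lc j)) 0 k)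
          (legChain (fun j => legComp (fun α x κ u => psiKS (ctrOff (d + 1) Lc) Lc u x (Sum.inl κ) (Sum.inl α)) (respStepBmSeq (d := d) (ctr (d + 1) Lc) Lc j)) 0 k)
          (legChain (fun j => legComp (fun α x κ u => psiKS (ctrOff (d + 1) Lc) Lc u x (Sum.inl κ) (Sum.inl α)) (respStepBmSeq (d := d) (ctr (d + 1) Lc) Lc j)) 0 k)
          (unitS (sfStep Lc 0) (smStep d Lc 0) (combFreshAt tabs 0 cΛ 0)) κ' u') (CT * ((((k + 1 : ℕ) : ℝ)) ^ p * θT ^ (k + 1))) δT)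
    (hP : ∃ CP Θ δP : ℝ, 0 ≤ CP ∧ 0 ≤ Θ ∧ Θ < 1 ∧ 0 < δP ∧ ∀ k i : ℕ, i < k →
      LocStencil
        ((fun κ' u' => (cE * (Lc : ℝ) ^ (2 * (d + 1))) ^ (k - i) •
            push₃
              (legChain (fun j => legComp (fun α x κ u => psiKS (ctrOff (d + 1) Lc) Lc u x (Sum.inl κ) (Sum.inl α)) (respStepBmSeq (d := d) (ctr (d + 1) Lc) Lc j)) (i + 1) (k - 1 - i))
              (legChain (fun j => legComp (fun α x κ u => psiKS (ctrOff (d + 1) Lc) Lc u x (Sum.inl κ) (Sum.inl α)) (respStepBmSeq (d := d) (ctr (d + 1) Lc) Lc j)) (i + 1) (k - 1 - i))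
              (legChain (fun j => legComp (fun α x κ u => psiKS (ctrOff (d + 1) Lc) Lc u x (Sum.inl κ) (Sum.inl α)) (respStepBmSeq (d := d) (ctr (d + 1) Lc) Lc j)) (i + 1) (k - 1 - i))
              (unitS (sfStep Lc (i + 1)) (smStep d Lc (i + 1)) (combFreshAt tabs 0 cΛ (i + 1))) κ' u')
          - fun κ' u' => (cE * (Lc : ℝ) ^ (2 * (d + 1))) ^ (k - i) •
            push₃
              (legChain (fun j => legComp (fun α x κ u => psiKS (ctrOff (d + 1) Lc) Lc u x (Sum.inl κ) (Sum.inl α)) (respStepBmSeq (d := d) (ctr (d + 1) Lc) Lc j)) i (k - 1 - i))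
              (legChain (fun j => legComp (fun α x κ u => psiKS (ctrOff (d + 1) Lc) Lc u x (Sum.inl κ) (Sum.inl α)) (respStepBmSeq (d := d) (ctr (d + 1) Lc) Lc j)) i (k - 1 - i))
              (legChain (fun j => legComp (fun α x κ u => psiKS (ctrOff (d + 1) Lc) Lc u x (Sum.inl κ) (Sum.inl α)) (respStepBmSeq (d := d) (ctr (d + 1) Lc) Lc j)) i (k - 1 - i))
              (unitS (sfStep Lc i) (smStep d Lc i) (combFreshAt tabs 0 cΛ i)) κ' u')
        (CP * ((((k - i : ℕ) : ℝ)) ^ q * Θ ^ k)) δP) :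
    ∃ cB θB δB : ℝ, 0 ≤ cB ∧ 0 ≤ θB ∧ θB < 1 ∧ 0 < δB ∧ ∀ k j : ℕ,
      LocStencil (unitS (sfStep Lc (k + j)) (smStep d Lc (k + j)) (combBornOf Lc tabs cE 0 cΛ (k + j))
        - unitS (sfStep Lc k) (smStep d Lc k) (combBornOf Lc tabs cE 0 cΛ k)) (cB * θB ^ k) δB := by
  obtain ⟨CF, θF, δF, hCF, hθF0, hθF1, hδF, hXd⟩ := hXd
  obtain ⟨CT, θT, δT, hCT, hθT0, hθT1, hδT, hT⟩ := hT
  obtain ⟨CP, Θ, δP, hCP, hΘ0, hΘ1, hδP, hP⟩ := hP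
  set δ : ℝ := min (min δF δT) δP with hδdef
  have hδ0 : 0 < δ := lt_min (lt_min hδF hδT) hδP
  have hδF' : δ ≤ δF := (min_le_left _ _).trans (min_le_left _ _)
  have hδT' : δ ≤ δT := (min_le_left _ _).trans (min_le_right _ _)
  have hδP' : δ ≤ δP := min_le_right _ _
  obtain ⟨C, θ, hC, hθ0, hθ1, hschema⟩ :=
    exists_consec_of_pairLetters (d := d) (δ := δ) (p := p) (q := q) hCF hθF0 hθF1 hCT hθT0 hθT1 hCP hΘ0 hΘ1
  have h1θ : 0 < 1 - θ := by linarith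
  refine ⟨C / (1 - θ), θ, δ, div_nonneg hC h1θ.le, hθ0.le, hθ1, hδ0, fun k j => ?_⟩
  have hconsec : ∀ k, LocStencil (unitS (sfStep Lc (k + 1)) (smStep d Lc (k + 1)) (combBornOf Lc tabs cE 0 cΛ (k + 1))
      - unitS (sfStep Lc k) (smStep d Lc k) (combBornOf Lc tabs cE 0 cΛ k)) (C * θ ^ k) δ := by
    intro k
    rw [unitS_combBornLam_eq_sum_push₃ tabs hHff cE cΛ (k + 1), unitS_combBornLam_eq_sum_push₃ tabs hHff cE cΛ k]
    refine hschema (fun k => unitS (sfStep Lc k) (smStep d Lc k) (combFreshAt tabs 0 cΛ k))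
      (fun i k => fun κ' u' => (cE * (Lc : ℝ) ^ (2 * (d + 1))) ^ (k - i) •
        push₃
          (legChain (fun j => legComp (fun α x κ u => psiKS (ctrOff (d + 1) Lc) Lc u x (Sum.inl κ) (Sum.inl α)) (respStepBmSeq (d := d) (ctr (d + 1) Lc) Lc j)) i (k - 1 - i))
          (legChain (fun j => legComp (fun α x κ u => psiKS (ctrOff (d + 1) Lc) Lc u x (Sum.inl κ) (Sum.inl α)) (respStepBmSeq (d := d) (ctr (d + 1) Lc) Lc j)) i (k - 1 - i))
          (legChain (fun j => legComp (fun α x κ u => psiKS (ctrOff (d + 1) Lc) Lc u x (Sum.inl κ) (Sum.inl α)) (respStepBmSeq (d := d) (ctr (d + 1) Lc) Lc j)) i (k - 1 - i))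
          (unitS (sfStep Lc i) (smStep d Lc i) (combFreshAt tabs 0 cΛ i)) κ' u')
      (fun k => locStencil_mono' (hXd k) le_rfl hδF') (fun k => ?_) (fun k i hik => ?_) k
    · -- the top lineage, raw indices `k + 1 - 0`, `k + 1 - 1 - 0` normalised
      have h := locStencil_mono' (hT k) le_rfl hδT'
      simp only [Nat.sub_zero, Nat.add_sub_cancel]
      exact h
    · -- the pair, raw indices `k + 1 - (i + 1)`, `k + 1 - 1 - (i + 1)` normalised
      have h := locStencil_mono' (hP k i hik) le_rfl hδP'
      have e2 : k - (i + 1) = k - 1 - i := by omega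
      simp only [Nat.add_sub_add_right, Nat.add_sub_cancel, e2]
      exact h
  exact locStencil_allScales_of_consec (U := fun k => unitS (sfStep Lc k) (smStep d Lc k) (combBornOf Lc tabs cE 0 cΛ k)) hC hθ0.le hθ1 hconsec k j

/-! ## §2 The V half: `hBdev(cVH,0)` at (III′) from two letters (the source drift is zero) -/

/-- NOT IN PRINT; OUR BOOKKEEPING (generic `d`, centred roots; a SOCKET; the (III′) twin of leaf-04's `BornBorderDrift.exists_hBdevV_of_letters`).  **THE RATE HALF OF THE
(III′) V-BORN ROW FROM TWO LETTERS**: a TOP-lineage letter `hT` (member `k+1`'s lineage born at the finest level: `transport combUnitStepMap 1 k (combUnitStepMap Lc cE 0 (cVH • tabs.V))`,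
constant `CT·(k+1)^p·θT^{k+1}`) and the TOP-ALIGNED PAIR letters `hP` (member `k+1`'s lineage born at `i+1` minus member `k`'s born at `i`: `CP·(k−i)^q·Θ^k`) give the
all-scales Cauchy letter of the unit tables of `combBornOf Lc tabs cE cVH 0` (ONE `cB, θB < 1, δB > 0` for all `k j`).  The source `cVH • tabs.V` is THE SAME TABLE at every
level (M.56 §1), so leaf-06's schema runs with the ZERO fresh drift. -/
theorem exists_hBdevV_of_letters (hVff : ∀ κ u x y (α β : Fin (d + 1)), tabs.V κ u x y (Sum.inl α) (Sum.inl β) = 0)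
    (hVmm : ∀ κ u x y (μ ν : Fin (d + 1)), tabs.V κ u x y (Sum.inr μ) (Sum.inr ν) = 0) (cE cVH : ℝ) {p q : ℕ}
    (hT : ∃ CT θT δT : ℝ, 0 ≤ CT ∧ 0 ≤ θT ∧ θT < 1 ∧ 0 < δT ∧ ∀ k : ℕ,
      LocStencil (transport (combUnitStepMap Lc cE) 1 k (combUnitStepMap Lc cE 0 (fun κ u => cVH • tabs.V κ u))) (CT * ((((k + 1 : ℕ) : ℝ)) ^ p * θT ^ (k + 1))) δT)
    (hP : ∃ CP Θ δP : ℝ, 0 ≤ CP ∧ 0 ≤ Θ ∧ Θ < 1 ∧ 0 < δP ∧ ∀ k i : ℕ, i < k →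
      LocStencil
        (transport (combUnitStepMap Lc cE) (i + 1 + 1) (k - 1 - i) (combUnitStepMap Lc cE (i + 1) (fun κ u => cVH • tabs.V κ u))
          - transport (combUnitStepMap Lc cE) (i + 1) (k - 1 - i) (combUnitStepMap Lc cE i (fun κ u => cVH • tabs.V κ u)))
        (CP * ((((k - i : ℕ) : ℝ)) ^ q * Θ ^ k)) δP) :
    ∃ cB θB δB : ℝ, 0 ≤ cB ∧ 0 ≤ θB ∧ θB < 1 ∧ 0 < δB ∧ ∀ k j : ℕ,
      LocStencil (unitS (sfStep Lc (k + j)) (smStep d Lc (k + j)) (combBornOf Lc tabs cE cVH 0 (k + j))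
        - unitS (sfStep Lc k) (smStep d Lc k) (combBornOf Lc tabs cE cVH 0 k)) (cB * θB ^ k) δB := by
  obtain ⟨CT, θT, δT, hCT, hθT0, hθT1, hδT, hT⟩ := hT
  obtain ⟨CP, Θ, δP, hCP, hΘ0, hΘ1, hδP, hP⟩ := hP
  set δ : ℝ := min δT δP with hδdef
  have hδ0 : 0 < δ := lt_min hδT hδP
  have hδT' : δ ≤ δT := min_le_left _ _
  have hδP' : δ ≤ δP := min_le_right _ _
  -- leaf-06's schema with the ZERO fresh drift (`CF = 0`, `θF = 0`)
  obtain ⟨C, θ, hC, hθ0, hθ1, hschema⟩ :=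
    exists_consec_of_pairLetters (d := d) (δ := δ) (p := p) (q := q) (le_refl (0 : ℝ)) (le_refl (0 : ℝ)) zero_lt_one hCT hθT0 hθT1 hCP hΘ0 hΘ1
  have h1θ : 0 < 1 - θ := by linarith
  refine ⟨C / (1 - θ), θ, δ, div_nonneg hC h1θ.le, hθ0.le, hθ1, hδ0, fun k j => ?_⟩
  have hF : ∀ k : ℕ, LocStencil ((fun _ : ℕ => fun κ u => cVH • tabs.V κ u) (k + 1) - (fun _ : ℕ => fun κ u => cVH • tabs.V κ u) k) (0 * (0 : ℝ) ^ k) δ := by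
    intro k
    simp only [sub_self, zero_mul]
    intro κ u x y a b
    simp
  have hconsec : ∀ k, LocStencil (unitS (sfStep Lc (k + 1)) (smStep d Lc (k + 1)) (combBornOf Lc tabs cE cVH 0 (k + 1))
      - unitS (sfStep Lc k) (smStep d Lc k) (combBornOf Lc tabs cE cVH 0 k)) (C * θ ^ k) δ := by
    intro k
    rw [unitS_combBornV_eq_sum tabs hVff hVmm cE cVH (k + 1), unitS_combBornV_eq_sum tabs hVff hVmm cE cVH k]
    refine hschema (fun _ => fun κ u => cVH • tabs.V κ u)
      (fun i k => transport (combUnitStepMap Lc cE) (i + 1) (k - 1 - i) (combUnitStepMap Lc cE i (fun κ u => cVH • tabs.V κ u)))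
      hF (fun k => ?_) (fun k i hik => ?_) k
    · -- the top lineage, raw indices `0 + 1`, `k + 1 - 1 - 0` normalised
      have h := locStencil_mono' (hT k) le_rfl hδT'
      rw [show k + 1 - 1 - 0 = k by omega]
      exact h
    · -- the pair, raw index `k + 1 - 1 - (i + 1)` normalised
      have h := locStencil_mono' (hP k i hik) le_rfl hδP'
      rw [show k + 1 - 1 - (i + 1) = k - 1 - i by omega]
      exact h
  exact locStencil_allScales_of_consec (U := fun k => unitS (sfStep Lc k) (smStep d Lc k) (combBornOf Lc tabs cE cVH 0 k)) hC hθ0.le hθ1 hconsec k j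

end Summit.QuantumFields.BalabanUV.Beta.GAN24.CombBornDriftSockets

end
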